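import Literature.Probability.LatticeModels.PointwiseScalingLimitScaleCovariant
import Literature.Probability.LatticeModels.CriticalUrsellFourSign
import Literature.Probability.LatticeModels.SourcedDoubleCurrentsSwitching
import HarnessLib

/-!
# Crux `IsingEuclidUpgradeR4NonGaussian` (stmt-CriticalPhenomena-0636): vocabulary of the line
# `free-covariance-delta-dichotomy` (with the current branch reshaped into the sibling line
# `four-current-coset-robustness`)

Route-posited objects (D-0016 `<Route>Defs`-type file) shared by the registered stubs of the checked
skeleton `Cruxes/IsingEuclidUpgradeR4NonGaussian/Lines/free-covariance-delta-dichotomy.lean` (line lead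
prover-line-stmt-CriticalPhenomena-0636-0, 2026-08-16) and by the crux file that composes them. Nothing is
asserted here: every declaration is a PARAMETRISED predicate or a finite-volume object over tree
definitions (`HasPointwiseScalingLimit`, `criticalCorr`, `NonCoincident`, `latticeApprox`,
`isingTwoPoint`, `sourcedDoubleCurrentLaw`, `doubleCurrentMeasure`, `freeBoxGraph`, `boxSources`,
`liftBonds`, `openConn`).

* §A (dispatcher vocabulary, card `free-covariance-delta-dichotomy`): `HasIndex ρ Δ` (ρ regularly
  varying of index `-Δ` along `δ → 0⁺`, Lamperti 1962 / Bingham–Goldie–Teugels §8.5),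
  `IsLimitWithIndex ρ S Δ` (the crux hypotheses + an index), `ScaleCovariantOn Δ S` (scale covariance
  on NON-COINCIDENT configurations — the output of the tree theorem
  `HasPointwiseScalingLimit.exists_rpow_scale_mem_Icc`).
* §B (current-branch vocabulary, card `four-current-coset-robustness`, VERBATIM its skeleton's objects):
  `lat`, `boxG`, `twoCurrentMeet` (`P²` of the proved box identity `connectedFour_free_box_eq`,
  ADC21 (3.11)), `fourCurrentLaw`, `FourMeet`, `fourCurrentMeet` (`P⁴`), `threePointRatio`,
  `boxMoment₁`, `twoStep`, `boxMoment₂` (ADC21 Lemma 4.4 / Prop. A.3 moments), `latU4` (the lattice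
  connected four-point function at mesh `δ`, verbatim the Disproof's).

Deliberately NOT here: the line's bare `Prop` statements (`Lamperti`, `EtaExists`, `CurrentBranch`,
`MarginalExclusion`, `LatticeU4RatioPositive`) — they live in the skeleton, and the registered stubs
are their explicit `∀`-forms over this vocabulary.

References: J. Lamperti, Trans. AMS 104 (1962) Thm 2; N. H. Bingham, C. M. Goldie, J. L. Teugels,
*Regular Variation* (1987) §1.4, §8.5; M. Aizenman, H. Duminil-Copin, Ann. Math. 194 (2021) =
arXiv:1912.07973, §3 (3.11)–(3.13), §4.2 Lemma 4.4, App. A Prop. A.3; P. Di Francesco, P. Mathieu,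
D. Sénéchal, *Conformal Field Theory* (1997) §4.3.1.
-/

noncomputable section

open Filter Topology Set Function MeasureTheory Finset
open Literature.Probability.LatticeModels Literature.Probability.Percolation
open scoped symmDiff

namespace Summit.CriticalPhenomena.Ising3DConformalLimit.Cruxes.IsingEuclidUpgradeR4NonGaussian.FreeCovarianceDeltaDichotomy

/-! ## §A. Index and covariance vocabulary -/

/-- `ρ` is REGULARLY VARYING OF INDEX `-Δ` along the mesh filter: `ρ(cδ)/ρ(δ) → c^{-Δ}` as
`δ → 0⁺`, for every fixed `c > 0` (Lamperti's normalising-constant lemma, transplanted to the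
renormalisation of a pointwise scaling limit). [cite: BinghamGoldieTeugels1987, §1.4 and §8.5] -/
def HasIndex (ρ : ℝ → ℝ) (Δ : ℝ) : Prop :=
  ∀ c : ℝ, 0 < c → Tendsto (fun δ => ρ (c * δ) / ρ δ) (𝓝[>] (0:ℝ)) (𝓝 (c ^ (-Δ)))

/-- The crux's hypotheses on `(ρ, S)` — `ρ > 0` on `(0,1]`, `S` a pointwise scaling limit of
`criticalCorr 3` with renormalisation `ρ`, non-degenerate two-point function — together with an
index `Δ` for `ρ`. [folklore] -/
def IsLimitWithIndex (ρ : ℝ → ℝ) (S : CorrFamily 3) (Δ : ℝ) : Prop :=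
  (∀ δ ∈ Set.Ioc (0:ℝ) 1, 0 < ρ δ) ∧ HasPointwiseScalingLimit (criticalCorr 3) ρ S ∧
    IsNondegenerateTwoPoint S ∧ HasIndex ρ Δ

/-- Scale covariance with exponent `Δ` on NON-COINCIDENT configurations:
`S n (c·x) = c^{-nΔ} S n x` for `c > 0`, `x ∈ NonCoincident 3 n` — the output of the tree's
Lamperti theorem `HasPointwiseScalingLimit.exists_rpow_scale_mem_Icc` (for a normalised family it is
`IsScaleCovariant Δ`). [cite: FrancescoMathieuSenechal1997, §4.3.1] -/
def ScaleCovariantOn (Δ : ℝ) (S : CorrFamily 3) : Prop :=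
  ∀ (n : ℕ) (c : ℝ), 0 < c → ∀ x ∈ NonCoincident 3 n,
    S n (fun i => c • x i) = c ^ (-(n : ℝ) * Δ) * S n x

/-! ## §B. Objects of the current branch (all finite-volume: the free box `Λ_L ⊂ ℤ³` at `β_c(3)`) -/

/-- The lattice point `x̃ᵢ = [xᵢ/δ]` of a macroscopic configuration `x`. [folklore] -/
abbrev lat (δ : ℝ) (x : Fin 4 → EuclideanSpace ℝ (Fin 3)) (i : Fin 4) : Site 3 :=
  latticeApprox δ (x i)

/-- The free-boundary box two-point function `G_L(u,v) = ⟨σ_uσ_v⟩⁰_{Λ_L,β_c(3)}`. [folklore] -/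
def boxG (L : ℕ) (u v : Site 3) : ℝ :=
  isingTwoPoint (zdGraph 3) (box 3 L) (criticalBeta 3) 0 .free u v

/-- `P² = P^{{a}∆{b},{c}∆{e}}_{Λ_L,β_c}[a ↔ c]`: the probability that the clusters of the two sourced
currents `n₁` (`∂n₁ = {a,b}`) and `n₂` (`∂n₂ = {c,e}`) are glued (`a ↔ c` in `n₁ + n₂`) — the
quantity of the box identity `U₄,Λ_L(a,b,c,e) = −2 G_L(a,b) G_L(c,e) · P²`
(`connectedFour_free_box_eq`). [cite: AizenmanDuminilCopinAnnals2021, eq. (3.11)] -/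
def twoCurrentMeet (L : ℕ) (a b c e : Site 3) : ℝ :=
  (sourcedDoubleCurrentLaw 3 L (criticalBeta 3) ({a} ∆ {b}) ({c} ∆ {e})).real (openConn a c)

/-- The FOUR-CURRENT law `P^{ab,∅}_{Λ_L} ⊗ P^{ce,∅}_{Λ_L}` of `((n₁,n₃),(n₂,n₄))`: two independent
sourced double currents of the free box graph, pairing `(n₁,n₃)`, `(n₂,n₄)` as in ADC21 (3.13).
[cite: AizenmanDuminilCopinAnnals2021, §3.2 eq. (3.13)] -/
def fourCurrentLaw (L : ℕ) (a b c e : Site 3) :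
    Measure ((Current (freeBoxGraph 3 L) × Current (freeBoxGraph 3 L)) ×
      (Current (freeBoxGraph 3 L) × Current (freeBoxGraph 3 L))) :=
  (doubleCurrentMeasure (freeBoxGraph 3 L) (criticalBeta 3) (boxSources 3 L ({a} ∆ {b})) ∅).prod
    (doubleCurrentMeasure (freeBoxGraph 3 L) (criticalBeta 3) (boxSources 3 L ({c} ∆ {e})) ∅)

/-- `MEET₄`: `a ↔ c` in the (lifted) trace of `n₁ + n₃ + n₂ + n₄` — the two fat clusters
`C_{n₁+n₃}(a)`, `C_{n₂+n₄}(c)` are glued (triage r1-3: conditioning on connection in the sum of all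
four currents, which contains `{a ↔ c in n₁+n₂}`). [cite: AizenmanDuminilCopinAnnals2021, §4.2, proof of Lemma 4.4] -/
def FourMeet (L : ℕ) (a c : Site 3) :
    Set ((Current (freeBoxGraph 3 L) × Current (freeBoxGraph 3 L)) ×
      (Current (freeBoxGraph 3 L) × Current (freeBoxGraph 3 L))) :=
  {pq | liftBonds 3 L ((pq.1.1 + pq.1.2) + (pq.2.1 + pq.2.2)).traced ∈ openConn a c}

/-- `P⁴ = P^{ab,∅}_{Λ_L} ⊗ P^{ce,∅}_{Λ_L}[MEET₄]`, the four-current gluing probability. [cite: AizenmanDuminilCopinAnnals2021, §4.2, Lemma 4.4] -/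
def fourCurrentMeet (L : ℕ) (a b c e : Site 3) : ℝ :=
  (fourCurrentLaw L a b c e).real (FourMeet L a c)

/-- The exact one-point density of a sourced double current (switching):
`P^{ab,∅}_{Λ_L}[v ∈ C_{n₁+n₃}(a)] = G_L(a,v)G_L(v,b)/G_L(a,b)`. [cite: AizenmanDuminilCopinAnnals2021, §4.2, proof of Lemma 4.4 (first display)] -/
def threePointRatio (L : ℕ) (a b v : Site 3) : ℝ :=
  boxG L a v * boxG L v b / boxG L a b

/-- FIRST MOMENT `M₁ = E⁴[N_A]` of the number `N_A` of sites of `A` in `C_{n₁+n₃}(a) ∩ C_{n₂+n₄}(c)`: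
`∑_{v ∈ A} (G(a,v)G(v,b)/G(a,b)) · (G(c,v)G(v,e)/G(c,e))`. [cite: AizenmanDuminilCopinAnnals2021, §4.2, proof of Lemma 4.4] -/
def boxMoment₁ (L : ℕ) (a b c e : Site 3) (A : Finset (Site 3)) : ℝ :=
  ∑ v ∈ A, threePointRatio L a b v * threePointRatio L c e v

/-- The two-step (tree) bound of ADC21 Prop. A.3 for a pair of sites:
`B_{ab}(v,w) = G(a,v)G(v,w)G(w,b) + G(a,w)G(w,v)G(v,b)`. [cite: AizenmanDuminilCopinAnnals2021, Appendix A.2, Proposition A.3] -/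
def twoStep (L : ℕ) (a b v w : Site 3) : ℝ :=
  boxG L a v * boxG L v w * boxG L w b + boxG L a w * boxG L w v * boxG L v b

/-- SECOND-MOMENT BOUND `M₂ ≥ E⁴[N_A²]`:
`∑_{v,w ∈ A} (B_{ab}(v,w)/G(a,b)) · (B_{ce}(v,w)/G(c,e))`. [cite: AizenmanDuminilCopinAnnals2021, §4.2, proof of Lemma 4.4 (second display)] -/
def boxMoment₂ (L : ℕ) (a b c e : Site 3) (A : Finset (Site 3)) : ℝ :=
  ∑ v ∈ A, ∑ w ∈ A, (twoStep L a b v w / boxG L a b) * (twoStep L c e v w / boxG L c e)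

/-- The lattice connected four-point function at the mesh-`δ` approximation of `x` (VERBATIM the
Disproof's `latU4`, restated so that this file does not import the living workfile). [folklore] -/
def latU4 (δ : ℝ) (x : Fin 4 → EuclideanSpace ℝ (Fin 3)) : ℝ :=
  criticalCorr 3 4 (fun i => latticeApprox δ (x i)) -
    (criticalCorr 3 2 ![latticeApprox δ (x 0), latticeApprox δ (x 1)] *
        criticalCorr 3 2 ![latticeApprox δ (x 2), latticeApprox δ (x 3)]
      + criticalCorr 3 2 ![latticeApprox δ (x 0), latticeApprox δ (x 2)] *
        criticalCorr 3 2 ![latticeApprox δ (x 1), latticeApprox δ (x 3)]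
      + criticalCorr 3 2 ![latticeApprox δ (x 0), latticeApprox δ (x 3)] *
        criticalCorr 3 2 ![latticeApprox δ (x 1), latticeApprox δ (x 2)])

/-! ## §C. Bookkeeping (the registered vocabulary stub through which this file lands `--supports`) -/

/-- **Registered bookkeeping stub `stub_vocabulary`**: scale covariance on non-coincident
configurations, solved for `S n x`: `S n x = c^{nΔ} S n (c • x)` (the exponent convention `c^{-nΔ}`). [folklore] -/
theorem stub_vocabulary :
    ∀ (Δ : ℝ) (S : CorrFamily 3), ScaleCovariantOn Δ S → ∀ (c : ℝ), 0 < c →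
      ∀ (n : ℕ), ∀ x ∈ NonCoincident 3 n, S n x = c ^ ((n : ℝ) * Δ) * S n (fun i => c • x i) := by
  intro Δ S h c hc n x hx
  rw [h n c hc x hx, ← mul_assoc, ← Real.rpow_add hc, show (n:ℝ) * Δ + -(n:ℝ) * Δ = 0 by ring,
    Real.rpow_zero, one_mul]

end Summit.CriticalPhenomena.Ising3DConformalLimit.Cruxes.IsingEuclidUpgradeR4NonGaussian.FreeCovarianceDeltaDichotomy

end
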